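import Summits.QuantumFields.BalabanUV.Beta.FP.RelInvPeriodisedSliced

/-!
# `BalabanUV.Beta.FP.RelInvPeriodisedChart` — road «FP» (binder row D1), ROUTE T row **(T-INV)**, CHART-GENERIC EDITION of
# `RelInvPeriodised` §3 + `RelInvPeriodisedSliced` §2–§3: **(T-INV) ON THE TORUS FOR ANY PERIODISABLE RELATIVE-INVERSE CHART** — for ANY
# two kernels `A 𝕄 : MKer (d+1) (Fib d)` (a resolvent and a bordered Hessian) and ANY root `ρ` such that, on the lattice, `RelInv A 𝕄 (axEc ρ Lc)`
# (an2's four rules), `A` and `𝕄` spread and `Lcℤ^{d+1}`-invariant, the multiplier block of `𝕄` zero and its borders antisymmetrically placed: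
# on every torus box `M` with `Lc ∣ M_i` the four matrix rules hold for `Ê := perF M (axEc ρ Lc)`, `Â := perF M A`, `M̂ := perF M 𝕄`, the live
# block of `M̂` is invertible with inverse the live block of `Â`, and — in the road's `kOff` ∕ `kBig` ∕ `kkt` currency, for ANY presentation of
# the slots — the sliced KKT is non-degenerate with the live corner of its inverse read off `Â` (signs displayed)

HONEST DEPENDENCY (page 1, mandatory): continuum YM on T⁴ ⇐ BetaPertH ∧ nine spine estimates (0/9 proved); BetaPertH ⇐ (D1) ∧ (D4) ∧
CAP+tail; G-an2-4 gates asym, D1 and NE2/3/4.  HONEST FRAMING (cell contract, verbatim): «discharging `BetaPertH` makes Bałaban's UV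
stability UNCONDITIONAL — a real constructive-QFT result; it is NOT the continuum limit and NOT the Clay problem.»  ABSOLUTE RULE (cell
charter, verbatim): «No internally-minted statement may enter as a cited fact. Every hypothesis is either kernel-proved in this package or a
verbatim quotation of a PUBLISHED theorem with page reference. The manuscript(s) under audit are NOT citable for their own disputed steps — they
are the thing under adjudication; programme-internal (2001/route/tribunal) claims are never citable.»

WHY (the (J-a) dictionary, an2 g39 `JA-TABLE` §3 (γ-sym) + the OWNER d1-p3 g19's located addition W-FP-19-23): the rooted (T-INV) series
(`RelInvPeriodised` → `…Sliced` → `…CombRows` → `…Coarse` → `…EffForm` → `…EffFormCoarse` → `…MinOp` → `…MinOpRecord`) is typed over the ROOTED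
chart (`𝕄 = bhKStepAt d (toSite r) Lc j`, `A = coDressKBmAt (toSite r) Lc (KInvStep Lc j)`); the chart-(III′) literal of record needs the SAME
identifications over `𝕄′ = bhKStepSh d Lc (Dsh Lc) j`, `A′ = GcombSh Lc j`.  The rooted proofs use the chart through five facts only; this
file (and its sequels `…ChartCombRows`, `…ChartEffForm`, `…ChartMinOp`) re-types them with those facts as DISPLAYED hypotheses, so that every
chart an2 supplies with (i) `RelInv` + spread + invariance, (ii) zero multiplier block, (iii) antisymmetric borders is served BY NAME
(instances: `FP/RelInvPeriodisedComb`).  The landed rooted files are untouched (they are the instance `ρ = toSite r`).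

CONTENT (proofs = the rooted proofs VERBATIM, the chart facts abstracted).  §1 lattice ⇒ torus structure: `perF_inr_inr_of_mm` (zero
multiplier block periodises to zero), `perF_inl_inr_eq_neg_of_anti` (antisymmetric borders periodise to negative-transposed borders,
`perF_transpose`).  §2 `perF_rules_of_relInv` (the four matrix rules, gan24-p3's `perF_relInv`), `torus_relInv_compress_of_relInv` (+ `_canonical`).
§3 the dress: `torus_kOff_of_relInv`, `torus_sliced_kkt_of_relInv`, `torus_isUnit_det_kkt_of_slots_of_relInv` (p309426's three theorems).
HYPOTHESIS ORDER (all sequels): `M`, root, `hM : Lc ∣ M_i`, `hA : Spr A`, `hMh : Spr 𝕄`, `hAt hMt` (`shiftK (Lc•t)`-invariance), `hrel`, then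
`hmm` (zero multiplier block), `hanti` (border antisymmetry) where used, then the presentation data as in the rooted theorem.
[folklore] bookkeeping BY NAME; no `Prop`, no `def`, nothing cited, 0 sorry; discharges NO binder of row D1; NOT (J-a), NOT (T-ID), NOT SDF,
NOT D1, NOT BetaPertH, NOT continuum, NOT Clay; 0 estimates.  Unit `b2b-balaban-beta-d1-formalise-leaf-05` (gen 29), 2026-08-22; no existing file touched.
-/

noncomputable section

open scoped BigOperators Matrix

namespace Summit.QuantumFields.BalabanUV.Beta.FP.RelInvPeriodisedChart

open Matrix
open Literature.MathematicalPhysics.QuantumFieldTheory.Balaban1983to89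
open Literature.MathematicalPhysics.QuantumFieldTheory.Balaban1983to89.Beta
open Literature.MathematicalPhysics.QuantumFieldTheory.Balaban1983to89.Beta.Composition (kkt)
open B4TorusKernel.MultiPeriod (translate)
open ExpKernelCalculus (MKer shiftK)
open OneStepResolventKernel (Fib)
open Summit.QuantumFields.BalabanUV.Beta.TameKernelCalculus (Spr)
open Summit.QuantumFields.BalabanUV.Beta.ChartConjugationRelative (RelInv)
open Summit.QuantumFields.BalabanUV.Beta.AxialDressingRooted (axEc spr_axEc)
open Summit.QuantumFields.BalabanUV.Beta.SaddleInverse (kBig kOff regroup isUnit_det_kBig_iff inv_kBig_apply)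
open Summit.QuantumFields.BalabanUV.Beta.FP.KernelPeriodisationFib (Idx perF perF_apply perZ_apply trF perF_transpose translate_invariant_of_shiftK)
open Summit.QuantumFields.BalabanUV.Beta.FP.KernelPeriodisationFibDec (perF_relInv)
open Summit.QuantumFields.BalabanUV.Beta.FP.RelInvCompression (kkt_fromRows_coordSlice_eq_kBig)
open Summit.QuantumFields.BalabanUV.Beta.FP.RelInvPeriodised (compress_of_rules perF_axEc axEc_diag_zero_or_one axEc_translate_invariant)
open Summit.QuantumFields.BalabanUV.Beta.FP.RelInvPeriodisedSliced (compress_of_rules_embedding isUnit_det_kOff_neg_left_iff inv_kOff_neg_left_apply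
  det_kkt_submatrix_equiv)

variable {d : ℕ} {Lc : ℕ} [NeZero Lc] (M : Fin (d + 1) → ℕ) [∀ μ, NeZero (M μ)]

/-! ## §1 Lattice ⇒ torus: the zero multiplier block and the antisymmetric borders periodise -/

section Structure

variable {Mh : MKer (d + 1) (Fib d)}

omit [NeZero Lc] [∀ μ, NeZero (M μ)] in
/-- [folklore] **A ZERO MULTIPLIER–MULTIPLIER BLOCK PERIODISES TO ZERO** (every box; a period sum of zeros). -/
theorem perF_inr_inr_of_mm (hmm : ∀ (x y : Fin (d + 1) → ℤ) (κ l : Fin (d + 1)), Mh x y (Sum.inr κ) (Sum.inr l) = 0)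
    (p q : Idx M (Fib d)) {κ l : Fin (d + 1)} (hp : p.2 = Sum.inr κ) (hq : q.2 = Sum.inr l) : perF M Mh p q = 0 := by
  rw [perF_apply, perZ_apply, hp, hq]
  simp only [hmm, tsum_zero]

omit [NeZero Lc] [∀ μ, NeZero (M μ)] in
/-- [folklore] **ANTISYMMETRICALLY PLACED BORDERS PERIODISE TO NEGATIVE-TRANSPOSED BORDERS** (every box `M` with `Lc ∣ M_i`):
`M̂ (p, inl κ) (q, inr l) = − M̂ (q, inr l) (p, inl κ)` (`perF_transpose` for the `Mℤ^{d+1}`-invariant kernel, then the entrywise antisymmetry under the period sum). -/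
theorem perF_inl_inr_eq_neg_of_anti (hM : ∀ i, Lc ∣ M i) (hMt : ∀ t : Fin (d + 1) → ℤ, shiftK ((Lc : ℤ) • t) Mh = Mh)
    (hanti : ∀ (x y : Fin (d + 1) → ℤ) (κ l : Fin (d + 1)), Mh x y (Sum.inl κ) (Sum.inr l) = -Mh y x (Sum.inr l) (Sum.inl κ))
    (p q : Idx M (Fib d)) {κ l : Fin (d + 1)} (hp : p.2 = Sum.inl κ) (hq : q.2 = Sum.inr l) :
    perF M Mh p q = -perF M Mh q p := by
  have hT := perF_transpose M (K := Mh) fun m x y a b => translate_invariant_of_shiftK M hMt hM m x y a b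
  have hqp : perF M Mh q p = perF M (trF Mh) p q := by rw [hT, transpose_apply]
  rw [hqp, perF_apply, perF_apply, perZ_apply, perZ_apply, hp, hq, ← tsum_neg]
  refine tsum_congr fun m => ?_
  exact hanti _ _ κ l

end Structure

/-! ## §2 The four matrix rules on the torus box and the compression, for any chart -/

section Rules

variable (ρ : Fin (d + 1) → ℤ) {A Mh : MKer (d + 1) (Fib d)}

/-- [folklore] **THE FOUR MATRIX RULES ON THE TORUS BOX, ANY CHART** (`perF_relInv`): from the lattice `RelInv A 𝕄 (axEc ρ Lc)`, spread and
`Lcℤ^{d+1}`-invariance of `A`, `𝕄` (and of `axEc`, which has both for every root): with `Ê := perF M (axEc ρ Lc)`, `Â := perF M A`, `M̂ := perF M 𝕄`: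
`Ê·Â = Â`, `Â·Ê = Â`, `Â·M̂·Ê = Ê`, `Ê·M̂·Â = Ê`. -/
theorem perF_rules_of_relInv (hM : ∀ i, Lc ∣ M i) (hA : Spr A) (hMh : Spr Mh)
    (hAt : ∀ t : Fin (d + 1) → ℤ, shiftK ((Lc : ℤ) • t) A = A) (hMt : ∀ t : Fin (d + 1) → ℤ, shiftK ((Lc : ℤ) • t) Mh = Mh)
    (hrel : RelInv A Mh (axEc ρ Lc)) :
    perF M (axEc ρ Lc) * perF M A = perF M A
      ∧ perF M A * perF M (axEc ρ Lc) = perF M A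
      ∧ perF M A * perF M Mh * perF M (axEc ρ Lc) = perF M (axEc ρ Lc)
      ∧ perF M (axEc ρ Lc) * perF M Mh * perF M A = perF M (axEc ρ Lc) :=
  perF_relInv M hA hMh (spr_axEc _ _) (translate_invariant_of_shiftK M hAt hM) (translate_invariant_of_shiftK M hMt hM)
    (axEc_translate_invariant ρ Lc M hM) hrel

/-- **[folklore] (T-INV) ON THE TORUS, COMPRESSED FORM, ANY CHART.**  For any decidable reading `P` of `axEc ρ Lc`'s diagonal on the torus box index
(`hP`), sorting live ⊕ dead along `Equiv.sumCompl P`: the LIVE BLOCK of `M̂` has a unit determinant, its inverse is the live block of `Â`, and `Â` is its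
live block padded by zeros. -/
theorem torus_relInv_compress_of_relInv (hM : ∀ i, Lc ∣ M i) (hA : Spr A) (hMh : Spr Mh)
    (hAt : ∀ t : Fin (d + 1) → ℤ, shiftK ((Lc : ℤ) • t) A = A) (hMt : ∀ t : Fin (d + 1) → ℤ, shiftK ((Lc : ℤ) • t) Mh = Mh)
    (hrel : RelInv A Mh (axEc ρ Lc)) (P : Idx M (Fib d) → Prop) [DecidablePred P]
    (hP : ∀ p : Idx M (Fib d), axEc ρ Lc p.1 p.1 p.2 p.2 = if P p then 1 else 0) :
    IsUnit (((perF M Mh).submatrix (Equiv.sumCompl P) (Equiv.sumCompl P)).toBlocks₁₁).det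
      ∧ (((perF M Mh).submatrix (Equiv.sumCompl P) (Equiv.sumCompl P)).toBlocks₁₁)⁻¹
          = ((perF M A).submatrix (Equiv.sumCompl P) (Equiv.sumCompl P)).toBlocks₁₁
      ∧ (perF M A).submatrix (Equiv.sumCompl P) (Equiv.sumCompl P)
          = Matrix.fromBlocks (((perF M A).submatrix (Equiv.sumCompl P) (Equiv.sumCompl P)).toBlocks₁₁) 0 0 0 := by
  obtain ⟨h1, h2, h3, h4⟩ := perF_rules_of_relInv M ρ hM hA hMh hAt hMt hrel
  refine compress_of_rules P ?_ h1 h2 h3 h4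
  rw [perF_axEc]
  congr 1
  funext p
  exact hP p

open Classical in
/-- **[folklore] (T-INV) ON THE TORUS, CANONICAL SORTING, ANY CHART**: the live set READ OFF `Ê` itself (`P p := axEc ρ Lc p̃ p̃ p.2 p.2 = 1`). -/
theorem torus_relInv_compress_canonical_of_relInv (hM : ∀ i, Lc ∣ M i) (hA : Spr A) (hMh : Spr Mh)
    (hAt : ∀ t : Fin (d + 1) → ℤ, shiftK ((Lc : ℤ) • t) A = A) (hMt : ∀ t : Fin (d + 1) → ℤ, shiftK ((Lc : ℤ) • t) Mh = Mh)
    (hrel : RelInv A Mh (axEc ρ Lc)) :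
    IsUnit (((perF M Mh).submatrix
        (Equiv.sumCompl fun p : Idx M (Fib d) => axEc ρ Lc p.1 p.1 p.2 p.2 = 1)
        (Equiv.sumCompl fun p : Idx M (Fib d) => axEc ρ Lc p.1 p.1 p.2 p.2 = 1)).toBlocks₁₁).det
      ∧ (((perF M Mh).submatrix
          (Equiv.sumCompl fun p : Idx M (Fib d) => axEc ρ Lc p.1 p.1 p.2 p.2 = 1)
          (Equiv.sumCompl fun p : Idx M (Fib d) => axEc ρ Lc p.1 p.1 p.2 p.2 = 1)).toBlocks₁₁)⁻¹
          = ((perF M A).submatrix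
              (Equiv.sumCompl fun p : Idx M (Fib d) => axEc ρ Lc p.1 p.1 p.2 p.2 = 1)
              (Equiv.sumCompl fun p : Idx M (Fib d) => axEc ρ Lc p.1 p.1 p.2 p.2 = 1)).toBlocks₁₁ := by
  obtain ⟨h1, h2, -⟩ := torus_relInv_compress_of_relInv M ρ hM hA hMh hAt hMt hrel
    (fun p : Idx M (Fib d) => axEc ρ Lc p.1 p.1 p.2 p.2 = 1) fun p => by
    rcases axEc_diag_zero_or_one ρ Lc (p.1 : Fin (d + 1) → ℤ) p.2 with h | h
    · rw [h, if_neg zero_ne_one]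
    · rw [h, if_pos rfl]
  exact ⟨h1, h2⟩

end Rules

/-! ## §3 The dress, any chart: (T-INV) on the torus in `kOff` ∕ `kBig` ∕ `kkt` currency, for any presentation of the slots -/

section Dress

variable (ρ : Fin (d + 1) → ℤ) {A Mh : MKer (d + 1) (Fib d)}

/-- **[folklore] (T-INV) ON THE TORUS, `kOff` FORM — ANY CHART, ANY LIVE PRESENTATION** (p309426 `torus_kOff` with the chart displayed).  Let
`f : o ⊕ c → Idx M (Fib d)` be injective with range the LIVE set of `axEc ρ Lc` (`hlive`) and with the `c`-slots multiplier slots (`hc`).  Then the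
compressed bordered Hessian `kOff (M̂∘(f inl, f inl)) (M̂∘(f inl, f inr)) (M̂∘(f inr, f inl))` has a unit determinant, its inverse is `Â.submatrix f f`,
and `Â` vanishes off live × live. -/
theorem torus_kOff_of_relInv (hM : ∀ i, Lc ∣ M i) (hA : Spr A) (hMh : Spr Mh)
    (hAt : ∀ t : Fin (d + 1) → ℤ, shiftK ((Lc : ℤ) • t) A = A) (hMt : ∀ t : Fin (d + 1) → ℤ, shiftK ((Lc : ℤ) • t) Mh = Mh)
    (hrel : RelInv A Mh (axEc ρ Lc))
    (hmm : ∀ (x y : Fin (d + 1) → ℤ) (κ l : Fin (d + 1)), Mh x y (Sum.inr κ) (Sum.inr l) = 0)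
    {o c : Type*} [Fintype o] [Fintype c] [DecidableEq o] [DecidableEq c]
    (f : o ⊕ c → Idx M (Fib d)) (hf : Function.Injective f)
    (hlive : ∀ p : Idx M (Fib d), axEc ρ Lc p.1 p.1 p.2 p.2 = 1 ↔ p ∈ Set.range f)
    (hc : ∀ a : c, ∃ m : Fin (d + 1), (f (Sum.inr a)).2 = Sum.inr m) :
    IsUnit (kOff ((perF M Mh).submatrix (f ∘ Sum.inl) (f ∘ Sum.inl)) ((perF M Mh).submatrix (f ∘ Sum.inl) (f ∘ Sum.inr))
        ((perF M Mh).submatrix (f ∘ Sum.inr) (f ∘ Sum.inl))).det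
      ∧ (kOff ((perF M Mh).submatrix (f ∘ Sum.inl) (f ∘ Sum.inl)) ((perF M Mh).submatrix (f ∘ Sum.inl) (f ∘ Sum.inr))
          ((perF M Mh).submatrix (f ∘ Sum.inr) (f ∘ Sum.inl)))⁻¹ = (perF M A).submatrix f f
      ∧ ∀ p q : Idx M (Fib d), (p ∉ Set.range f ∨ q ∉ Set.range f) → perF M A p q = 0 := by
  classical
  -- the live reading of `axEc`'s diagonal along `range f`
  have hP : ∀ p : Idx M (Fib d), axEc ρ Lc p.1 p.1 p.2 p.2 = if p ∈ Set.range f then (1 : ℝ) else 0 := by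
    intro p
    by_cases h : p ∈ Set.range f
    · rw [if_pos h]; exact (hlive p).2 h
    · rw [if_neg h]
      exact (axEc_diag_zero_or_one ρ Lc (p.1 : Fin (d + 1) → ℤ) p.2).resolve_right fun h1 => h ((hlive p).1 h1)
  have hE : perF M (axEc ρ Lc) = Matrix.diagonal fun p : Idx M (Fib d) => if p ∈ Set.range f then (1 : ℝ) else 0 := by
    rw [perF_axEc]; congr 1; funext p; exact hP p
  obtain ⟨h1, h2, h3, h4⟩ := perF_rules_of_relInv M ρ hM hA hMh hAt hMt hrel
  obtain ⟨hU, hI, hA0⟩ := compress_of_rules_embedding (fun p : Idx M (Fib d) => p ∈ Set.range f) f hf (fun _ => Iff.rfl) hE h1 h2 h3 h4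
  -- the presented live block IS `kOff`: its multiplier–multiplier corner vanishes
  have hkOff : (perF M Mh).submatrix f f
      = kOff ((perF M Mh).submatrix (f ∘ Sum.inl) (f ∘ Sum.inl)) ((perF M Mh).submatrix (f ∘ Sum.inl) (f ∘ Sum.inr))
          ((perF M Mh).submatrix (f ∘ Sum.inr) (f ∘ Sum.inl)) := by
    ext (i | a) (i' | a') <;> try rfl
    · obtain ⟨m, hm⟩ := hc a
      obtain ⟨m', hm'⟩ := hc a'
      rw [kOff, fromBlocks_apply₂₂, submatrix_apply, Matrix.zero_apply]
      exact perF_inr_inr_of_mm M hmm _ _ hm hm'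
  rw [hkOff] at hU hI
  exact ⟨hU, hI, fun p q hpq => hA0 p q fun h => hpq.elim (fun hp => hp h.1) fun hq => hq h.2⟩

/-- **[folklore] (T-INV) ON THE TORUS, SLICED-KKT FORM — ANY CHART, ANY PRESENTATION** (p309426 `torus_sliced_kkt` with the chart displayed).  In the
setting of `torus_kOff_of_relInv`, let moreover the `o`-slots be FIELD slots (`ho`), the borders of `𝕄` antisymmetrically placed (`hanti`), and let
`g : t → Idx M (Fib d)` be ANY presentation of further fine bonds (the comb bonds).  Read off `M̂` the fine Hessian `[[Aoo, Aot],[Ato, Att]]` and the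
averaging rows `[Co | Ct]`.  Then the road's SLICED KKT `kkt [[Aoo,Aot],[Ato,Att]] [[Co,Ct];[0,1]]` has a unit determinant, and the live corner of
its inverse is `+Â` on field rows, `−Â` on multiplier rows. -/
theorem torus_sliced_kkt_of_relInv (hM : ∀ i, Lc ∣ M i) (hA : Spr A) (hMh : Spr Mh)
    (hAt : ∀ t : Fin (d + 1) → ℤ, shiftK ((Lc : ℤ) • t) A = A) (hMt : ∀ t : Fin (d + 1) → ℤ, shiftK ((Lc : ℤ) • t) Mh = Mh)
    (hrel : RelInv A Mh (axEc ρ Lc))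
    (hmm : ∀ (x y : Fin (d + 1) → ℤ) (κ l : Fin (d + 1)), Mh x y (Sum.inr κ) (Sum.inr l) = 0)
    (hanti : ∀ (x y : Fin (d + 1) → ℤ) (κ l : Fin (d + 1)), Mh x y (Sum.inl κ) (Sum.inr l) = -Mh y x (Sum.inr l) (Sum.inl κ))
    {o c t : Type*} [Fintype o] [Fintype c] [Fintype t] [DecidableEq o] [DecidableEq c] [DecidableEq t]
    (f : o ⊕ c → Idx M (Fib d)) (hf : Function.Injective f)
    (hlive : ∀ p : Idx M (Fib d), axEc ρ Lc p.1 p.1 p.2 p.2 = 1 ↔ p ∈ Set.range f)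
    (ho : ∀ i : o, ∃ α : Fin (d + 1), (f (Sum.inl i)).2 = Sum.inl α)
    (hc : ∀ a : c, ∃ m : Fin (d + 1), (f (Sum.inr a)).2 = Sum.inr m) (g : t → Idx M (Fib d)) :
    IsUnit (kkt (fromBlocks ((perF M Mh).submatrix (f ∘ Sum.inl) (f ∘ Sum.inl)) ((perF M Mh).submatrix (f ∘ Sum.inl) g)
          ((perF M Mh).submatrix g (f ∘ Sum.inl)) ((perF M Mh).submatrix g g))
        (fromRows (fromCols ((perF M Mh).submatrix (f ∘ Sum.inr) (f ∘ Sum.inl)) ((perF M Mh).submatrix (f ∘ Sum.inr) g))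
          (fromCols (0 : Matrix t o ℝ) (1 : Matrix t t ℝ)))).det
      ∧ ∀ x y : o ⊕ c,
        (kkt (fromBlocks ((perF M Mh).submatrix (f ∘ Sum.inl) (f ∘ Sum.inl)) ((perF M Mh).submatrix (f ∘ Sum.inl) g)
            ((perF M Mh).submatrix g (f ∘ Sum.inl)) ((perF M Mh).submatrix g g))
          (fromRows (fromCols ((perF M Mh).submatrix (f ∘ Sum.inr) (f ∘ Sum.inl)) ((perF M Mh).submatrix (f ∘ Sum.inr) g))
            (fromCols (0 : Matrix t o ℝ) (1 : Matrix t t ℝ))))⁻¹ (regroup o c t (Sum.inl x)) (regroup o c t (Sum.inl y))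
          = Sum.elim (fun _ => (1 : ℝ)) (fun _ => -1) x * perF M A (f x) (f y) := by
  set Mp := perF M Mh with hMp
  -- the top border of the torus bordered Hessian is `−Coᵀ`
  have hCof : Mp.submatrix (f ∘ Sum.inl) (f ∘ Sum.inr) = -(Mp.submatrix (f ∘ Sum.inr) (f ∘ Sum.inl))ᵀ := by
    ext i a
    obtain ⟨α, hα⟩ := ho i
    obtain ⟨m, hm⟩ := hc a
    rw [neg_apply, transpose_apply, submatrix_apply, submatrix_apply]
    exact perF_inl_inr_eq_neg_of_anti M hM hMt hanti _ _ hα hm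
  obtain ⟨hU, hI, -⟩ := torus_kOff_of_relInv M ρ hM hA hMh hAt hMt hrel hmm f hf hlive hc
  rw [hCof] at hU hI
  have hU' : IsUnit (kOff (Mp.submatrix (f ∘ Sum.inl) (f ∘ Sum.inl)) (Mp.submatrix (f ∘ Sum.inr) (f ∘ Sum.inl))ᵀ
      (Mp.submatrix (f ∘ Sum.inr) (f ∘ Sum.inl))).det := (isUnit_det_kOff_neg_left_iff _ _ _).1 hU
  rw [kkt_fromRows_coordSlice_eq_kBig]
  refine ⟨(isUnit_det_kBig_iff _ _ _ _ _ _ _ _).2 hU', fun x y => ?_⟩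
  rw [inv_kBig_apply _ _ _ _ _ _ _ _ hU' x y]
  -- `kOff A Coᵀ Co = kOff A (−(−Coᵀ)) Co`: the inverse is that of `kOff A (−Coᵀ) Co = Â∘f` with the multiplier rows negated
  have hI' := inv_kOff_neg_left_apply (Mp.submatrix (f ∘ Sum.inl) (f ∘ Sum.inl)) (-(Mp.submatrix (f ∘ Sum.inr) (f ∘ Sum.inl))ᵀ)
    (Mp.submatrix (f ∘ Sum.inr) (f ∘ Sum.inl)) hU x y
  rw [neg_neg] at hI'
  rw [hI', hI, submatrix_apply]

/-- **[folklore] (T-INV) ON THE TORUS, SLOT-MAP FORM, ANY CHART — the shape of binder `h1`** (p309426 `torus_isUnit_det_kkt_of_slots` with the chart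
displayed).  Fine bonds by an injective FIELD slot map `fν`, coarse multipliers by an injective MULTIPLIER slot map `fμ`, the comb by an injective
`cb : ρ₁ → ν`, the `axEc ρ Lc`-live set being `fν''(ν ∖ range cb) ∪ range fμ` (`hlive`); with `H₀ := M̂∘(fν,fν)`, `Q₁₀ := M̂∘(fμ,fν)` and the comb-COORDINATE
rows `τ₁ x b := [b = cb x]`, the sliced KKT `kkt H₀ [Q₁₀; τ₁]` has a unit determinant. -/
theorem torus_isUnit_det_kkt_of_slots_of_relInv (hM : ∀ i, Lc ∣ M i) (hA : Spr A) (hMh : Spr Mh)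
    (hAt : ∀ t : Fin (d + 1) → ℤ, shiftK ((Lc : ℤ) • t) A = A) (hMt : ∀ t : Fin (d + 1) → ℤ, shiftK ((Lc : ℤ) • t) Mh = Mh)
    (hrel : RelInv A Mh (axEc ρ Lc))
    (hmm : ∀ (x y : Fin (d + 1) → ℤ) (κ l : Fin (d + 1)), Mh x y (Sum.inr κ) (Sum.inr l) = 0)
    (hanti : ∀ (x y : Fin (d + 1) → ℤ) (κ l : Fin (d + 1)), Mh x y (Sum.inl κ) (Sum.inr l) = -Mh y x (Sum.inr l) (Sum.inl κ))
    {ν μ ρ₁ : Type*} [Fintype ν] [Fintype μ] [Fintype ρ₁] [DecidableEq ν] [DecidableEq μ] [DecidableEq ρ₁]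
    (fν : ν → Idx M (Fib d)) (fμ : μ → Idx M (Fib d)) (hfν : Function.Injective fν) (hfμ : Function.Injective fμ)
    (hν : ∀ b : ν, ∃ α : Fin (d + 1), (fν b).2 = Sum.inl α) (hμ : ∀ a : μ, ∃ m : Fin (d + 1), (fμ a).2 = Sum.inr m)
    (cb : ρ₁ → ν) (hcb : Function.Injective cb)
    (hlive : ∀ p : Idx M (Fib d),
      axEc ρ Lc p.1 p.1 p.2 p.2 = 1 ↔ (∃ b, b ∉ Set.range cb ∧ fν b = p) ∨ p ∈ Set.range fμ) :
    IsUnit (kkt ((perF M Mh).submatrix fν fν)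
      (fromRows ((perF M Mh).submatrix fμ fν) (Matrix.of fun (x : ρ₁) (b : ν) => if b = cb x then (1 : ℝ) else 0))).det := by
  classical
  set Mp := perF M Mh with hMp
  -- live presentation `f := fν off the comb ⊕ fμ`, dead presentation `g := fν ∘ cb`; then re-index `ν ≃ (ν ∖ range cb) ⊕ ρ₁`
  let f : {b : ν // b ∉ Set.range cb} ⊕ μ → Idx M (Fib d) := Sum.elim (fun b => fν b) fμ
  let g : ρ₁ → Idx M (Fib d) := fun x => fν (cb x)
  have hf : Function.Injective f := by
    rintro (b | a) (b' | a') h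
    · exact congrArg Sum.inl (Subtype.ext (hfν h))
    · obtain ⟨α, hα⟩ := hν b; obtain ⟨m, hm⟩ := hμ a'
      have e : (fν b).2 = (fμ a').2 := congrArg Prod.snd h; rw [hα, hm] at e; exact absurd e Sum.inl_ne_inr
    · obtain ⟨α, hα⟩ := hν b'; obtain ⟨m, hm⟩ := hμ a
      have e : (fμ a).2 = (fν b').2 := congrArg Prod.snd h; rw [hα, hm] at e; exact absurd e Sum.inr_ne_inl
    · exact congrArg Sum.inr (hfμ h)
  have hlive' : ∀ p : Idx M (Fib d), axEc ρ Lc p.1 p.1 p.2 p.2 = 1 ↔ p ∈ Set.range f := by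
    intro p
    rw [hlive p]
    constructor
    · rintro (⟨b, hb, rfl⟩ | ⟨a, rfl⟩)
      exacts [⟨Sum.inl ⟨b, hb⟩, rfl⟩, ⟨Sum.inr a, rfl⟩]
    · rintro ⟨b | a, rfl⟩
      exacts [Or.inl ⟨b, b.2, rfl⟩, Or.inr ⟨a, rfl⟩]
  obtain ⟨hU, -⟩ := torus_sliced_kkt_of_relInv M ρ hM hA hMh hAt hMt hrel hmm hanti f hf hlive' (fun b => hν b) hμ g
  let eν : {b : ν // b ∉ Set.range cb} ⊕ ρ₁ ≃ ν :=
    ((Equiv.sumComm _ _).trans (Equiv.sumCongr (Equiv.ofInjective cb hcb) (Equiv.refl _))).trans (Equiv.sumCompl fun b => b ∈ Set.range cb)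
  have heν_inl : ∀ b : {b : ν // b ∉ Set.range cb}, eν (Sum.inl b) = b := fun b => rfl
  have heν_inr : ∀ x : ρ₁, eν (Sum.inr x) = cb x := fun x => rfl
  have hsys : kkt ((Mp.submatrix fν fν).submatrix eν eν)
        ((fromRows (Mp.submatrix fμ fν) (Matrix.of fun (x : ρ₁) (b : ν) => if b = cb x then (1 : ℝ) else 0)).submatrix
          (Equiv.refl (μ ⊕ ρ₁)) eν)
      = kkt (fromBlocks (Mp.submatrix (f ∘ Sum.inl) (f ∘ Sum.inl)) (Mp.submatrix (f ∘ Sum.inl) g) (Mp.submatrix g (f ∘ Sum.inl))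
            (Mp.submatrix g g))
          (fromRows (fromCols (Mp.submatrix (f ∘ Sum.inr) (f ∘ Sum.inl)) (Mp.submatrix (f ∘ Sum.inr) g))
            (fromCols (0 : Matrix ρ₁ {b : ν // b ∉ Set.range cb} ℝ) (1 : Matrix ρ₁ ρ₁ ℝ))) := by
    congr 1
    · ext (b | x) (b' | x') <;> rfl
    · ext (a | x) (b' | x') <;> try rfl
      · simp only [submatrix_apply, Equiv.refl_apply, fromRows_apply_inr, fromCols_apply_inl, of_apply, heν_inl, Matrix.zero_apply]
        exact if_neg fun h : (b' : ν) = cb x => b'.2 ⟨x, h.symm⟩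
      · simp only [submatrix_apply, Equiv.refl_apply, fromRows_apply_inr, fromCols_apply_inr, of_apply, heν_inr]
        by_cases h : x = x'
        · subst h; rw [if_pos rfl, Matrix.one_apply_eq]
        · rw [if_neg fun e => h (hcb e).symm, Matrix.one_apply_ne h]
  rw [← det_kkt_submatrix_equiv _ _ eν (Equiv.refl (μ ⊕ ρ₁)), hsys]
  exact hU

end Dress

end Summit.QuantumFields.BalabanUV.Beta.FP.RelInvPeriodisedChart

end
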